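import Mathlib
import Summits.ResolutionOfSingularities.ResolutionOfSingularities.Theses.PAlteration
import Literature.AlgebraicGeometry.Resolution.RegularDerivationQuotient
import Literature.AlgebraicGeometry.Resolution.RegularHomReduced
import Literature.AlgebraicGeometry.Resolution.ProjectiveSpaceRegular

/-!
# ResolutionOfSingularities / pAlteration — `PicoverLocalModel`: the transversal case
(supports stmt-ResolutionOfSingularities-0557)

Route `pAlteration`, crux `PicoverLocalModel` (rank 5): for a prime `p`, a field `k` of
characteristic `p`, a regular finitely generated `k`-domain `R` and `a ∈ R`, the reduced local
model `X_a := Spec ((R[T]/(T^p - a))_red)` has a resolution of singularities.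

This file settles the **transversal case**: if some derivation `D` of `R` takes `a` to a unit —
equivalently (derivations form an `R`-module, so the values `D a` form an ideal) if for every
maximal ideal `𝔪` of `R` some derivation has `D a ∉ 𝔪` — then `R[T]/(T^p - a)` is itself a
REGULAR ring (Stacks, Tag 07PG, in tree as
`Literature.AlgebraicGeometry.Resolution.isRegularRing_adjoinRoot_X_pow_sub_C_of_derivation`:
`R[T]` is regular and the coefficientwise extension of `D` maps `T^p - a` to the unit `-D a`, so
`T^p - a ∉ 𝔔⁽²⁾` at every prime), hence reduced, so `X_a = Spec (R[T]/(T^p - a))` is regular and is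
its own resolution. In other words the singular locus of the `α_p`-torsor `t^p = a` lies over the
closed set `V(D a : D ∈ Der(R))` of the base ("`da = 0`"); every line of attack on the crux only
has to deal with that locus. (Example: `R = k[x₁,…,xₙ]`, `a = x₁ + g(x₂,…,xₙ)`: `∂a/∂x₁ = 1`.)

Contents:
* `hasResolution_Spec_quotient_nilradical_of_isRegularRing` — for a regular ring `A`,
  `Spec (A ⧸ nilradical A) ≅ Spec A` has a resolution;
* `hasResolution_localModel_of_isUnit_derivation` — the transversal case with one derivation;
* `exists_derivation_isUnit_of_forall_maximal` — pointwise non-vanishing at all maximal ideals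
  gives one derivation with `D a` a unit (partition of unity in the `R`-module of derivations);
* `picoverLocalModel_of_derivation` — the crux in its binder form with the extra transversality
  hypothesis, all primes and all dimensions.

No statement item is restated; nothing here claims the crux for `dim R ≥ 4` in general.
-/

-- `Summit.<Summit>.<Sub>.Theorems` with `Sub = Summit` (single-conjunct summit, D-0017).
set_option linter.dupNamespace false

namespace Summit.ResolutionOfSingularities.ResolutionOfSingularities.Theorems

open Polynomial AlgebraicGeometry CategoryTheory Literature.AlgebraicGeometry.Resolution

universe u

section Transversal

variable {R : Type u} [CommRing R]

/-- For a reduced ring `A` the reduction `A ⧸ nilradical A` is isomorphic to `A` (the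
nilradical vanishes). [folklore] -/
theorem nonempty_quotient_nilradical_ringEquiv_of_isReduced (A : Type u) [CommRing A]
    [IsReduced A] : Nonempty ((A ⧸ nilradical A) ≃+* A) :=
  ⟨(Ideal.quotEquivOfEq ((nilradical_eq_zero A).trans Ideal.zero_eq_bot)).trans
    (RingEquiv.quotientBot A)⟩

/-- **A regular ring needs no resolution**: for a regular (Noetherian) ring `A`, the reduced
scheme `Spec (A ⧸ nilradical A) = Spec A` (a regular ring is reduced) is regular, hence is its
own resolution. [folklore] -/
theorem hasResolution_Spec_quotient_nilradical_of_isRegularRing (A : Type u) [CommRing A]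
    [IsRegularRing A] : Scheme.HasResolution (Spec (.of (A ⧸ nilradical A))) := by
  haveI : IsReduced A := IsRegularRing.isReduced' A
  obtain ⟨e⟩ := nonempty_quotient_nilradical_ringEquiv_of_isReduced A
  haveI : IsRegularRing (A ⧸ nilradical A) := IsRegularRing.of_ringEquiv e.symm
  haveI : IsRegularRing (CommRingCat.of (A ⧸ nilradical A)) := ‹_›
  exact (Scheme.isRegular_Spec (.of (A ⧸ nilradical A))).hasResolution

/-- **The transversal case of the local model** (all exponents `n`, all dimensions, any regular
base ring): if a derivation `D` of the regular ring `R` takes `a` to a unit, then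
`R[T]/(Tⁿ - a)` is regular (Stacks, Tag 07PG) and so the reduced local model
`Spec ((R[T]/(Tⁿ - a))_red) = Spec (R[T]/(Tⁿ - a))` has a resolution (the identity).
[cite: StacksProject, Tag 07PG] -/
theorem hasResolution_localModel_of_isUnit_derivation [IsRegularRing R] (D : Derivation ℤ R R)
    {a : R} (ha : IsUnit (D a)) (n : ℕ) :
    Scheme.HasResolution (Spec (.of
      (AdjoinRoot (X ^ n - C a) ⧸ nilradical (AdjoinRoot (X ^ n - C a))))) := by
  haveI : IsRegularRing (AdjoinRoot ((X : R[X]) ^ n - C a)) :=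
    isRegularRing_adjoinRoot_X_pow_sub_C_of_derivation D a ha n
  exact hasResolution_Spec_quotient_nilradical_of_isRegularRing _

/-- **Partition of unity for derivations**: if for every maximal ideal `𝔪` of `R` some
derivation `D` of `R` has `D a ∉ 𝔪`, then a single derivation takes `a` to a unit (indeed to
`1`): the values `D a` form an ideal (derivations are an `R`-module) contained in no maximal
ideal. [folklore] -/
theorem exists_derivation_isUnit_of_forall_maximal {a : R}
    (h : ∀ m : Ideal R, m.IsMaximal → ∃ D : Derivation ℤ R R, D a ∉ m) :
    ∃ D : Derivation ℤ R R, IsUnit (D a) := by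
  -- evaluation at `a` is `R`-linear on the `R`-module of derivations; its range is an ideal
  let ev : Derivation ℤ R R →ₗ[R] R :=
    { toFun := fun D => D a, map_add' := fun _ _ => rfl, map_smul' := fun _ _ => rfl }
  have htop : LinearMap.range ev = ⊤ := by
    by_contra hne
    obtain ⟨m, hm, hle⟩ := Ideal.exists_le_maximal _ hne
    obtain ⟨D, hD⟩ := h m hm
    exact hD (hle ⟨D, rfl⟩)
  have h1 : (1 : R) ∈ LinearMap.range ev := htop ▸ Submodule.mem_top
  obtain ⟨D, hD⟩ := h1
  exact ⟨D, by rw [← show ev D = D a from rfl, hD]; exact isUnit_one⟩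

/-- The transversal case, pointwise form: if at every maximal ideal of the regular ring `R` some
derivation does not kill `a` to first order (`D a ∉ 𝔪`), the reduced local model
`Spec ((R[T]/(Tⁿ - a))_red)` has a resolution — it is regular. [cite: StacksProject, Tag 07PG] -/
theorem hasResolution_localModel_of_forall_maximal_exists_derivation [IsRegularRing R] {a : R}
    (h : ∀ m : Ideal R, m.IsMaximal → ∃ D : Derivation ℤ R R, D a ∉ m) (n : ℕ) :
    Scheme.HasResolution (Spec (.of
      (AdjoinRoot (X ^ n - C a) ⧸ nilradical (AdjoinRoot (X ^ n - C a))))) := by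
  obtain ⟨D, hD⟩ := exists_derivation_isUnit_of_forall_maximal h
  exact hasResolution_localModel_of_isUnit_derivation D hD n

end Transversal

/-! ## Corollary in the binder form of the crux `PicoverLocalModel` -/

section Crux

/-- **`PicoverLocalModel` in the transversal case** (all primes, all dimensions): the crux
statement with the extra hypothesis that at every maximal ideal `𝔪` of `R` some derivation `D`
of `R` has `D a ∉ 𝔪` ("`da` vanishes nowhere"). Then `R[T]/(T^p - a)` is regular (Stacks 07PG)
and the local model is its own resolution. The hypotheses `Field k`, `FiniteType`, `IsDomain`
are not used: only `IsRegularRing R`. The open case of the crux is the locus `da = 0`.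
[cite: StacksProject, Tag 07PG] -/
theorem picoverLocalModel_of_derivation :
    ∀ p : ℕ, p.Prime → ∀ (k : Type) [Field k] [CharP k p] (R : Type) [CommRing R] [IsDomain R]
      [Algebra k R], Algebra.FiniteType k R → IsRegularRing R → ∀ a : R,
      (∀ m : Ideal R, m.IsMaximal → ∃ D : Derivation ℤ R R, D a ∉ m) →
      Literature.AlgebraicGeometry.Resolution.Scheme.HasResolution (AlgebraicGeometry.Spec (.of
        (AdjoinRoot (Polynomial.X ^ p - Polynomial.C a) ⧸
          nilradical (AdjoinRoot (Polynomial.X ^ p - Polynomial.C a))))) := by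
  intro p _ k _ _ R _ _ _ _ _ a h
  exact hasResolution_localModel_of_forall_maximal_exists_derivation h p

end Crux

end Summit.ResolutionOfSingularities.ResolutionOfSingularities.Theorems
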